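import Literature.NumberTheory.GaloisCohomology.Howard2004.DVRSettingPiRefinementLevelData
import Literature.NumberTheory.GaloisCohomology.Howard2004.CartesianBaseChangeProofs
import Literature.NumberTheory.GaloisCohomology.Howard2004.DVRSettingPiRefinementTowerProofs
import Literature.NumberTheory.GaloisCohomology.Howard2004.TowerMorphismPushforward
import HarnessLib

/-!
# The morphism «`T` read along `i ↦ host(i+1)`» → «`T♯` = the π-adic refinement» of tower settings:
# the level maps `proj`, the maps of the Kolyvagin quotients, and their compatibilities (Rem. 1.2.4)

Topic `NumberTheory/GaloisCohomology/Howard2004`. Definitions with bodies (`refineStep`, `refineF`, `levelπR`,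
`refineFQuot`, `refineFq`, `refinedQuotRep`) + theorems; no named fact, no instance, no notation, no `sorry`. Cell
`pub/bsd-print-x9`, print leaf G87 `Literature.NumberTheory.GaloisCohomology.Howard2004.thm161_dvrKolyvaginBound`
(Howard Thm. 1.6.1); seat `bsd-line-x10b-p1` LEAD g12, brick «R7-KS» part A of the π-adic REFINEMENT programme: the
DATA and COMPATIBILITIES of the morphism of tower settings from «`S` re-indexed along its host levels» (the tree's
`CoeffTowerSetting.reindex (S.host hy 1) (S.refineStep hy)`, levels `T^{(host(i+1))}`) to the refined setting `S♯`
(x10b-p1-w2 g16's `refinedCarrier` / `refinedRep` / `refinedRed` / `refinedRq` / `refinedLD`, p699597), along which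
the Kolyvagin system `κ♯` of `S♯` is the PUSHFORWARD of `κ` (Rem. 1.2.4, `CoeffTowerSetting.Hom.pushforward`) —
part B (the `Hom` and `κ♯`, once `DVRSetting.refine` lands) consumes exactly the fields proved here.

SOURCE. B. Howard, *The Heegner point Kolyvagin system*, Compositio Math. **140** (2004) = arXiv:1202.6340: Rem.
1.2.4 «if `R → R′` is a ring homomorphism there is a map `KS(T,F,𝓛) ⊗_R R′ → KS(T ⊗_R R′, F ⊗_R R′, 𝓛)`» (p. 7
L13–27); §1.6 «`T^{(k)} = T/𝔪^kT` … we obtain, by Remark (functorality), a Kolyvagin system `κ^{(k)} ∈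
KS(T^{(k)}, F, 𝓛^{(k)})`» (p. 11 L33–47).  Here `R′ = R/π^{i+1}` and `T ⊗ R′ = T^{(host)}/π^{i+1}T^{(host)}`.

WHAT IS HERE (for `S : DVRSetting …`, `hy`, `D := S.piRefinementDatum hy`; the SOURCE level of the refined level `i`
is `idxSeq (S.host hy 1) (S.refineStep hy) i`, which `idxSeq_host` identifies with `S.host hy (i+1)`).
* §1 `refineStep`, **`idxSeq_host`** (the hosts ARE an `idxSeq`, so `CoeffTowerSetting.reindex` /
  `KolyvaginSystem.reindex` apply), `host_le_idxSeq`, `succ_le_e_idxSeq`.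
* §2 **`refineF S hy i : N (idxSeq … i) →+ S.refinedCarrier hy i`** (= `D.proj`, literal codomain), `refineF_smul`
  (`f_smul`, φ = id), `refineF_equivariant` (`f_equivariant`), **`refineF_red`** (`f_red`: `proj ∘ redIter = red♯ ∘
  proj`), **`refineF_smul_levelRing`** (`proj (a·x) = toQuotRing(a)·proj x`), `refineF_eq_zero_iff`
  (`ker = (ker toQuotRing)·T^{(k)}`).
* §3 `levelπR`, `refineFQuot`, `ker_levelπR_le_ker_refineFQuot` (via w2 g16's
  `map_mem_levelIdeal_smul_top_of_ringChange`), **`refineFq S hy i n : Nq (idxSeq … i) n →ₗ[R] QuotCarrier …`**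
  (the map of the Kolyvagin quotients, by `descend`), **`refineFq_comp`** / `refineFq_comp'` (`fq ∘ π_n = π♯_n ∘ f`),
  `refinedQuotRep` (the quotient action, `= (S.refinedLD hy pins i).ρq n` by `rfl`), **`refineFq_equivariant`**,
  **`refineFq_rq`** (`fq ∘ rqIter = rq♯ ∘ fq`).
* §4 **`map_refineF_cond_eq`** (`cond_le` with equality: `H¹(proj)(F_{idxSeq i} v) = refinedCond (i+1) v`).
* §5 **`refineFq_fs_compat`** (`fs_compat`, for a TAME-PINNED source `htame : ∀ k, (S.LD k).fs = tameSlotOn pins …`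
  with the guard `n ∈ 𝓝(𝓛) ∧ λ ∈ n` of `refinedLD`: the tame slots commute with `H¹(K_λ, fq)` / `H¹_s(K_λ, fq)`,
  `tameSlotOn_natural_cohomologyMap`).

HONEST FRAMING. Plumbing; the Kolyvagin system `κ♯` itself (part B) and `thm161_dvrKolyvaginBound` are NOT here; no
summit statement is proved; the Birch–Swinnerton-Dyer conjecture is not proved by any of this.
References: [Howard2004HeegnerKolyvagin] Rem. 1.2.4, Def. 1.2.3, §1.6; [SerreGaloisCohomology1997] I §2.2.
-/

set_option autoImplicit false

noncomputable section

open Function NumberField IsDedekindDomain Field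
open scoped NumberField TensorProduct

namespace Literature.NumberTheory.GaloisCohomology.Howard2004

open Literature.NumberTheory.GaloisRepresentations
open Literature.NumberTheory.GaloisRepresentations.DiscreteGaloisModule

namespace DVRSetting

variable {p : ℕ} [Fact p.Prime] {K : Type} [Field K] [NumberField K]
  {R : Type} [CommRing R] [IsDomain R] [IsDiscreteValuationRing R] [Algebra ℤ_[p] R]
  {N : ℕ → Type} [∀ k, AddCommGroup (N k)] [∀ k, TopologicalSpace (N k)]
  [∀ k, DiscreteTopology (N k)] [∀ k, Module R (N k)]
  {Rk : ℕ → Type} [∀ k, CommRing (Rk k)] [∀ k, IsLocalRing (Rk k)] [∀ k, TopologicalSpace (Rk k)]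
  [∀ k, DiscreteTopology (Rk k)] [∀ k, Algebra ℤ_[p] (Rk k)] [∀ k, Algebra R (Rk k)]
  [∀ k, Module (Rk k) (N k)] [∀ k, IsScalarTower R (Rk k) (N k)]
  {Nbar : Type} [AddCommGroup Nbar] [TopologicalSpace Nbar] [DiscreteTopology Nbar]
  [∀ k, Module (Rk k) Nbar]
  {Nq : ℕ → Finset (HeightOneSpectrum (𝓞 K)) → Type} [∀ k n, AddCommGroup (Nq k n)]
  [∀ k n, TopologicalSpace (Nq k n)] [∀ k n, DiscreteTopology (Nq k n)]
  [∀ k n, Module (Rk k) (Nq k n)] [∀ k n, Module R (Nq k n)]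
  [∀ k n, IsScalarTower R (Rk k) (Nq k n)]

/-! ## §1 The host levels as an index sequence -/

/-- The steps `host(i+2) - host(i+1)` of the host sequence (written `i+1+1` to match `idxSeq`). [cite: Howard2004HeegnerKolyvagin, §1.6 (arXiv p. 12, L29–33)] -/
def refineStep (S : DVRSetting p K R N Rk Nbar Nq) (hy : S.SatisfiesH) (i : ℕ) : ℕ :=
  S.host hy (i + 1 + 1) - S.host hy (i + 1)

/-- **The hosts `k ↦ host(k+1)` ARE the index sequence `idxSeq (host 1) refineStep`** (so the tree's
`CoeffTowerSetting.reindex` / `KolyvaginSystem.reindex` along it read `T` exactly at the host levels of the refined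
setting). [cite: Howard2004HeegnerKolyvagin, §1.6 (arXiv p. 12, L29–33)] -/
theorem idxSeq_host (S : DVRSetting p K R N Rk Nbar Nq) (hy : S.SatisfiesH) (i : ℕ) :
    idxSeq (S.host hy 1) (S.refineStep hy) i = S.host hy (i + 1) := by
  induction i with
  | zero => rfl
  | succ i ih =>
    rw [idxSeq_succ, ih, refineStep]
    have h : S.host hy (i + 1) ≤ S.host hy (i + 1 + 1) := S.host_mono hy (by omega)
    omega

/-- `host(i+1) ≤ idxSeq (host 1) refineStep i` (the form `proj` consumes). [cite: Howard2004HeegnerKolyvagin, §1.6 (arXiv p. 12, L29–33)] -/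
theorem host_le_idxSeq (S : DVRSetting p K R N Rk Nbar Nq) (hy : S.SatisfiesH) (i : ℕ) :
    (S.piRefinementDatum hy).host (i + 1) ≤ idxSeq (S.host hy 1) (S.refineStep hy) i :=
  (S.idxSeq_host hy i).symm.le

/-- `i + 1 ≤ e (idxSeq … i)`. [cite: Howard2004HeegnerKolyvagin, §1.6 (arXiv p. 11 L33–36)] -/
theorem succ_le_e_idxSeq (S : DVRSetting p K R N Rk Nbar Nq) (hy : S.SatisfiesH) (i : ℕ) :
    i + 1 ≤ S.e (idxSeq (S.host hy 1) (S.refineStep hy) i) :=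
  S.le_e_of_host_le hy (S.host_le_idxSeq hy i)

/-! ## §2 The level maps `f_i = proj : T^{(host)} ↠ T/π^{i+1}T` -/

/-- **The level map of the morphism**: `proj : T^{(idxSeq i)} ↠ T/π^{i+1}T` with its LITERAL codomain
`S.refinedCarrier hy i` (so that the `R/π^{i+1}`-action on the target is found by instance search).
[cite: Howard2004HeegnerKolyvagin, §1.6 and Rem. 1.2.4 (iii) (arXiv p. 12 L29–33, p. 7 L19–27)] -/
def refineF (S : DVRSetting p K R N Rk Nbar Nq) (hy : S.SatisfiesH) (i : ℕ) :
    N (idxSeq (S.host hy 1) (S.refineStep hy) i) →+ S.refinedCarrier hy i :=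
  ((S.piRefinementDatum hy).proj (S.host_le_idxSeq hy i)).toAddMonoidHom

/-- Unfolding `refineF`. [cite: Howard2004HeegnerKolyvagin, §1.6 (arXiv p. 12, L29–33)] -/
theorem refineF_apply (S : DVRSetting p K R N Rk Nbar Nq) (hy : S.SatisfiesH) (i : ℕ)
    (x : N (idxSeq (S.host hy 1) (S.refineStep hy) i)) :
    S.refineF hy i x = (S.piRefinementDatum hy).proj (S.host_le_idxSeq hy i) x := rfl

/-- `refineF` is `R`-linear (`φ = id`). [cite: Howard2004HeegnerKolyvagin, Rem. 1.2.4 (iii) (arXiv p. 7, L19–27)] -/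
theorem refineF_smul (S : DVRSetting p K R N Rk Nbar Nq) (hy : S.SatisfiesH) (i : ℕ) (r : R)
    (x : N (idxSeq (S.host hy 1) (S.refineStep hy) i)) :
    S.refineF hy i (r • x) = (RingHom.id R) r • S.refineF hy i x := by
  rw [refineF_apply, refineF_apply, map_smul, RingHom.id_apply]
  rfl

/-- `refineF` is `Γ_K`-equivariant. [cite: Howard2004HeegnerKolyvagin, Rem. 1.2.4 (iii) (arXiv p. 7, L19–27)] -/
theorem refineF_equivariant (S : DVRSetting p K R N Rk Nbar Nq) (hy : S.SatisfiesH) (i : ℕ)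
    (σ : absoluteGaloisGroup K) (x : N (idxSeq (S.host hy 1) (S.refineStep hy) i)) :
    S.refineF hy i (S.T.ρ _ σ x) = S.refinedRep hy i σ (S.refineF hy i x) :=
  S.proj_equivariant hy (S.host_le_idxSeq hy i) σ x

/-- **`refineF` commutes with the reductions**: `proj_i (redIter x) = red♯_i (proj_{i+1} x)` for the iterated
reduction `T^{(idxSeq (i+1))} ↠ T^{(idxSeq i)}` of the re-indexed tower and the reduction `T/π^{i+2} ↠ T/π^{i+1}`.
[cite: Howard2004HeegnerKolyvagin, §1.6 (arXiv p. 12, L29–33)] -/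
theorem refineF_red (S : DVRSetting p K R N Rk Nbar Nq) (hy : S.SatisfiesH) (i : ℕ)
    (x : N (idxSeq (S.host hy 1) (S.refineStep hy) (i + 1))) :
    S.refineF hy i (S.T.redIter (idxSeq (S.host hy 1) (S.refineStep hy) i) (S.refineStep hy i) x) =
      S.refinedRed hy i (S.refineF hy (i + 1) x) := by
  rw [refineF_apply, refineF_apply]
  have e1 : S.T.redIter (idxSeq (S.host hy 1) (S.refineStep hy) i) (S.refineStep hy i) x =
      (S.piRefinementDatum hy).red (Nat.le_add_right _ _) x :=
    (AdicTower.redLE_eq_redIter S.T _ _ x).symm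
  rw [e1, (S.piRefinementDatum hy).proj_red]
  change _ = (S.piRefinementDatum hy).map (i + 1 + 1) (i + 1) ((S.piRefinementDatum hy).proj _ x)
  rw [(S.piRefinementDatum hy).map_proj (i + 1 + 1) (i + 1) (S.host_le_idxSeq hy (i + 1))
    ((S.host_le_idxSeq hy i).trans (Nat.le_add_right _ _)), Nat.sub_eq_zero_of_le (Nat.le_succ _),
    pow_zero, one_smul]
  rfl

/-- **`refineF` is `toQuotRing`-semilinear**: `proj (a · x) = toQuotRing(a) · proj x` for `a ∈ R_{idxSeq i}`.
[cite: Howard2004HeegnerKolyvagin, §1.6 (arXiv p. 11 L33–36: `R^{(k)} = R/𝔪^k`, `T^{(k)} = T/𝔪^kT`)] -/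
theorem refineF_smul_levelRing (S : DVRSetting p K R N Rk Nbar Nq) (hy : S.SatisfiesH) (i : ℕ)
    (a : Rk (idxSeq (S.host hy 1) (S.refineStep hy) i)) (x : N (idxSeq (S.host hy 1) (S.refineStep hy) i)) :
    S.refineF hy i (a • x) = S.toQuotRing hy (S.succ_le_e_idxSeq hy i) a • S.refineF hy i x := by
  obtain ⟨r, rfl⟩ := hy.algebraMap_surjective _ a
  rw [S.toQuotRing_algebraMap hy, algebraMap_smul, refineF_apply, refineF_apply, map_smul,
    PiRefinementDatum.proj_apply]
  rfl

/-- `refineF x = 0 ↔ x ∈ (ker toQuotRing) · T^{(idxSeq i)}`. [cite: Howard2004HeegnerKolyvagin, §1.6 (arXiv p. 11 L33–36)] -/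
theorem refineF_eq_zero_iff (S : DVRSetting p K R N Rk Nbar Nq) (hy : S.SatisfiesH) (i : ℕ)
    (x : N (idxSeq (S.host hy 1) (S.refineStep hy) i)) :
    S.refineF hy i x = 0 ↔ x ∈ (RingHom.ker (S.toQuotRing hy (S.succ_le_e_idxSeq hy i)) •
      (⊤ : Submodule (Rk (idxSeq (S.host hy 1) (S.refineStep hy) i)) (N (idxSeq (S.host hy 1) (S.refineStep hy) i))) :
        Submodule (Rk (idxSeq (S.host hy 1) (S.refineStep hy) i)) (N (idxSeq (S.host hy 1) (S.refineStep hy) i))) := by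
  rw [S.ker_toQuotRing hy, ← S.mem_span_pi_pow_smul_top_iff, refineF_apply]
  have hk := (S.piRefinementDatum hy).ker_proj (S.host_le_idxSeq hy i)
  constructor
  · intro h0
    have hx : x ∈ LinearMap.ker ((S.piRefinementDatum hy).proj (S.host_le_idxSeq hy i)) := h0
    rw [hk] at hx
    exact hx
  · intro hx
    have hx' : x ∈ LinearMap.ker ((S.piRefinementDatum hy).proj (S.host_le_idxSeq hy i)) := by
      rw [hk]; exact hx
    exact hx'

/-! ## §3 The maps of the Kolyvagin quotients `fq_{i,n} : T^{(host)}/I_n → (T/π^{i+1}T)/I_n` -/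

/-- The presentation `T^{(k)} ↠ T^{(k)}/I_n` read `R`-linearly. [cite: Howard2004HeegnerKolyvagin, Def. 1.2.3 (arXiv p. 7, L1–6)] -/
abbrev levelπR (S : DVRSetting p K R N Rk Nbar Nq) (k : ℕ) (n : Finset (HeightOneSpectrum (𝓞 K))) :
    N k →ₗ[R] Nq k n :=
  ((S.LD k).π n).restrictScalars R

/-- The composite `T^{(idxSeq i)} ↠ T/π^{i+1}T ↠ (T/π^{i+1}T)/I_n`, read `R`-linearly.
[cite: Howard2004HeegnerKolyvagin, Def. 1.2.3 and Rem. 1.2.4 (arXiv p. 7, L1–27)] -/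
def refineFQuot (S : DVRSetting p K R N Rk Nbar Nq) (hy : S.SatisfiesH) (i : ℕ)
    (n : Finset (HeightOneSpectrum (𝓞 K))) :
    N (idxSeq (S.host hy 1) (S.refineStep hy) i) →ₗ[R]
      LevelData.QuotCarrier (S.QuotRing (i + 1)) (S.refinedRep hy i) n :=
  ((levelIdeal (R := S.QuotRing (i + 1)) (S.refinedRep hy i) n •
      (⊤ : Submodule (S.QuotRing (i + 1)) (S.refinedCarrier hy i))).mkQ.restrictScalars R) ∘ₗ
    (S.piRefinementDatum hy).proj (S.host_le_idxSeq hy i)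

/-- Unfolding: `refineFQuot x = [proj x]`. [cite: Howard2004HeegnerKolyvagin, Def. 1.2.3 (arXiv p. 7, L1–6)] -/
theorem refineFQuot_apply (S : DVRSetting p K R N Rk Nbar Nq) (hy : S.SatisfiesH) (i : ℕ)
    (n : Finset (HeightOneSpectrum (𝓞 K))) (x : N (idxSeq (S.host hy 1) (S.refineStep hy) i)) :
    S.refineFQuot hy i n x = Submodule.Quotient.mk (S.refineF hy i x) := rfl

/-- The composite kills `I_n · T^{(idxSeq i)}` (Rem. 1.2.4: `I_n` is compatible with the ring change
`R_k → R/π^{i+1}`, `map_mem_levelIdeal_smul_top_of_ringChange`). [cite: Howard2004HeegnerKolyvagin, Def. 1.2.1 and Rem. 1.2.4 (arXiv p. 6 L63–75, p. 7 L13–27)] -/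
theorem ker_levelπR_le_ker_refineFQuot (S : DVRSetting p K R N Rk Nbar Nq) (hy : S.SatisfiesH) (i : ℕ)
    (n : Finset (HeightOneSpectrum (𝓞 K))) :
    LinearMap.ker (S.levelπR (idxSeq (S.host hy 1) (S.refineStep hy) i) n) ≤
      LinearMap.ker (S.refineFQuot hy i n) := by
  intro x hx
  rw [LinearMap.mem_ker] at hx ⊢
  have hx' : x ∈ (levelIdeal (R := Rk (idxSeq (S.host hy 1) (S.refineStep hy) i)) (S.T.ρ (idxSeq (S.host hy 1) (S.refineStep hy) i)) n •
      (⊤ : Submodule (Rk (idxSeq (S.host hy 1) (S.refineStep hy) i)) (N (idxSeq (S.host hy 1) (S.refineStep hy) i))) : Submodule (Rk (idxSeq (S.host hy 1) (S.refineStep hy) i)) (N (idxSeq (S.host hy 1) (S.refineStep hy) i))) := by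
    rw [← ((S.LD (idxSeq (S.host hy 1) (S.refineStep hy) i)).isQuotientBy n).ker_eq, LinearMap.mem_ker]
    exact hx
  rw [refineFQuot_apply, Submodule.Quotient.mk_eq_zero]
  exact map_mem_levelIdeal_smul_top_of_ringChange (S.T.ρ _) (S.refinedRep hy i)
    (S.toQuotRing hy (S.succ_le_e_idxSeq hy i)) (S.toQuotRing_surjective hy _) (S.refineF hy i)
    ((S.piRefinementDatum hy).proj_surjective _) (fun a m => S.refineF_smul_levelRing hy i a m)
    (fun g m => S.refineF_equivariant hy i g m) (fun m hm => (S.refineF_eq_zero_iff hy i m).mp hm) n hx'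

/-- **The map of the Kolyvagin quotients `fq_{i,n} : T^{(idxSeq i)}/I_n → (T/π^{i+1}T)/I_n`** induced by `proj`
(first isomorphism theorem along the presentation `π_n`). [cite: Howard2004HeegnerKolyvagin, Rem. 1.2.4 (iii) and Def. 1.2.3 (arXiv p. 7, L1–27)] -/
def refineFq (S : DVRSetting p K R N Rk Nbar Nq) (hy : S.SatisfiesH) (i : ℕ)
    (n : Finset (HeightOneSpectrum (𝓞 K))) :
    Nq (idxSeq (S.host hy 1) (S.refineStep hy) i) n →ₗ[R]
      LevelData.QuotCarrier (S.QuotRing (i + 1)) (S.refinedRep hy i) n :=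
  descend (S.levelπR _ n) (((S.LD _).isQuotientBy n).surjective) (S.refineFQuot hy i n)
    (S.ker_levelπR_le_ker_refineFQuot hy i n)

/-- **`fq ∘ π_n = π♯_n ∘ f`**: `fq [x] = [proj x]` (the field `fq_comp`). [cite: Howard2004HeegnerKolyvagin, Rem. 1.2.4 (iii) (arXiv p. 7, L19–27)] -/
theorem refineFq_comp (S : DVRSetting p K R N Rk Nbar Nq) (hy : S.SatisfiesH) (i : ℕ)
    (n : Finset (HeightOneSpectrum (𝓞 K))) (x : N (idxSeq (S.host hy 1) (S.refineStep hy) i)) :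
    S.refineFq hy i n ((S.LD _).π n x) = Submodule.Quotient.mk (S.refineF hy i x) :=
  descend_apply (S.levelπR _ n) _ (S.refineFQuot hy i n) _ x

/-- The same with the refined presentation spelled `(S.refinedLD hy pins i).π n` (which is `mk` by `rfl`).
[cite: Howard2004HeegnerKolyvagin, Rem. 1.2.4 (iii) (arXiv p. 7, L19–27)] -/
theorem refineFq_comp' (S : DVRSetting p K R N Rk Nbar Nq) (hy : S.SatisfiesH)
    (pins : ∀ v : HeightOneSpectrum (𝓞 K), TamePin v) (i : ℕ)
    (n : Finset (HeightOneSpectrum (𝓞 K))) (x : N (idxSeq (S.host hy 1) (S.refineStep hy) i)) :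
    S.refineFq hy i n ((S.LD _).π n x) = (S.refinedLD hy pins i).π n (S.refineF hy i x) :=
  S.refineFq_comp hy i n x

/-- The `Γ_K`-action on the refined Kolyvagin quotient `(T/π^{i+1}T)/I_n` (the canonical quotient action; `=
(S.refinedLD hy pins i).ρq n` by `rfl`, `refinedLD_ρq`), spelled explicitly so that no `LevelData` is unfolded.
[cite: Howard2004HeegnerKolyvagin, Def. 1.2.3 (arXiv p. 7, L1–6)] -/
abbrev refinedQuotRep (S : DVRSetting p K R N Rk Nbar Nq) (hy : S.SatisfiesH) (i : ℕ)
    (n : Finset (HeightOneSpectrum (𝓞 K))) :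
    DiscreteGaloisModule K (LevelData.QuotCarrier (S.QuotRing (i + 1)) (S.refinedRep hy i) n) :=
  modIdeal (S.refinedRep hy i) (S.isScalarLinear_modIdeal_quotRing (i + 1) _)
    (levelIdeal (R := S.QuotRing (i + 1)) (S.refinedRep hy i) n)

/-- `refinedQuotRep` is the action of the refined level data (`rfl`). [cite: Howard2004HeegnerKolyvagin, Def. 1.2.3 (arXiv p. 7, L1–6)] -/
theorem refinedLD_ρq_eq_refinedQuotRep (S : DVRSetting p K R N Rk Nbar Nq) (hy : S.SatisfiesH)
    (pins : ∀ v : HeightOneSpectrum (𝓞 K), TamePin v) (i : ℕ) (n : Finset (HeightOneSpectrum (𝓞 K))) :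
    (S.refinedLD hy pins i).ρq n = S.refinedQuotRep hy i n := rfl

/-- `fq` is `Γ_K`-equivariant for the quotient actions. [cite: Howard2004HeegnerKolyvagin, Rem. 1.2.4 (iii) (arXiv p. 7, L19–27)] -/
theorem refineFq_equivariant (S : DVRSetting p K R N Rk Nbar Nq) (hy : S.SatisfiesH) (i : ℕ)
    (n : Finset (HeightOneSpectrum (𝓞 K))) (σ : absoluteGaloisGroup K)
    (y : Nq (idxSeq (S.host hy 1) (S.refineStep hy) i) n) :
    S.refineFq hy i n ((S.LD _).ρq n σ y) = S.refinedQuotRep hy i n σ (S.refineFq hy i n y) := by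
  obtain ⟨x, rfl⟩ := ((S.LD _).isQuotientBy n).surjective y
  rw [← ((S.LD _).isQuotientBy n).equivariant, refineFq_comp, refineFq_comp, refineF_equivariant,
    modIdeal_apply_mk]

/-- **`fq` commutes with the reductions in the level** (`fq_rq`): along the iterated quotient reduction
`T^{(idxSeq (i+1))}/I_n ↠ T^{(idxSeq i)}/I_n` of the re-indexed setting and the refined `rq♯`.
[cite: Howard2004HeegnerKolyvagin, §1.6 and Rem. 1.2.4 (arXiv p. 11 L49–50, p. 7 L13–27)] -/
theorem refineFq_rq (S : DVRSetting p K R N Rk Nbar Nq) (hy : S.SatisfiesH) (i : ℕ)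
    (n : Finset (HeightOneSpectrum (𝓞 K))) (y : Nq (idxSeq (S.host hy 1) (S.refineStep hy) (i + 1)) n) :
    S.refineFq hy i n (S.toCoeffTowerSetting.rqIter (idxSeq (S.host hy 1) (S.refineStep hy) i) n
        (S.refineStep hy i) y) =
      S.refinedRq hy i n (S.refineFq hy (i + 1) n y) := by
  obtain ⟨x, rfl⟩ := ((S.LD _).isQuotientBy n).surjective y
  have h1 : S.toCoeffTowerSetting.rqIter (idxSeq (S.host hy 1) (S.refineStep hy) i) n (S.refineStep hy i)
      ((S.LD (idxSeq (S.host hy 1) (S.refineStep hy) (i + 1))).π n x) =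
      (S.LD (idxSeq (S.host hy 1) (S.refineStep hy) i)).π n
        (S.T.redIter (idxSeq (S.host hy 1) (S.refineStep hy) i) (S.refineStep hy i) x) :=
    S.toCoeffTowerSetting.rqIter_comp (idxSeq (S.host hy 1) (S.refineStep hy) i) n (S.refineStep hy i) x
  rw [h1, refineFq_comp, refineFq_comp, refinedRq_mk, refineF_red]

/-! ## §4 The local conditions: `H¹(proj)(F_{idxSeq i}) = F♯_i` (`cond_le` with equality) -/

/-- **The refined local condition is the image of the host-level one under `H¹(K_v, proj)`** from ANY source level
(here `idxSeq i`): the field `cond_le` of the morphism, with equality (w2 g16's `refinedCond_apply_eq_map`).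
[cite: Howard2004HeegnerKolyvagin, Def. 1.1.3 and Rem. 1.2.4 (ii) (arXiv p. 5 L98–99, p. 7 L13–27)] -/
theorem map_refineF_cond_eq (S : DVRSetting p K R N Rk Nbar Nq) (hy : S.SatisfiesH) (i : ℕ) (v : Place K) :
    ((S.t (idxSeq (S.host hy 1) (S.refineStep hy) i)).cond v).map
        (ContinuousRep.cohomologyMap ((S.T.ρ _).toLocal v) ((S.refinedRep hy i).toLocal v) (S.refineF hy i)
          continuous_of_discreteTopology (fun _ x => S.refineF_equivariant hy i _ x) 1) =
      S.refinedCond hy (i + 1) v :=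
  (S.refinedCond_apply_eq_map hy (S.host_le_idxSeq hy i) v).symm

/-! ## §5 The finite–singular slots commute with the change (tame-pinned source) -/

/-- **`fs_compat` for a TAME-PINNED source**: if the slots of `S` are the guarded tame slots of the pin family
`pins` (guard `n ∈ 𝓝(𝓛) ∧ λ ∈ n`, the guard of the refined level data), then the finite–singular maps commute
with `H¹(K_λ, fq)` / `H¹_s(K_λ, fq)` on ALL classes (both slots are evaluations of cocycles, natural in the module;
off the guard both vanish).  The refined slot is written as the guarded tame slot of `refinedQuotRep` (=
`(S.refinedLD hy pins i).fs` by `rfl`, `refinedLD_fs`).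
[cite: Howard2004HeegnerKolyvagin, Prop. 1.1.7 / Def. 1.1.8 and Rem. 1.2.4 (arXiv p. 5 L129–149, p. 7 L13–27)] -/
theorem refineFq_fs_compat (S : DVRSetting p K R N Rk Nbar Nq) (hy : S.SatisfiesH)
    (pins : ∀ v : HeightOneSpectrum (𝓞 K), TamePin v) [∀ k n, Finite (Nq k n)]
    (hPS : ∀ k n v, (n ∈ levels S.L ∧ v ∈ n) → TameHyp (S.LD k).ρq n v)
    (htame : ∀ k, (S.LD k).fs = tameSlotOn pins (S.LD k).ρq (fun n v => n ∈ levels S.L ∧ v ∈ n) (hPS k))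
    (i : ℕ) (n : Finset (HeightOneSpectrum (𝓞 K))) (v : HeightOneSpectrum (𝓞 K))
    (c : galoisCohomology (GaloisRep.toLocal v ((S.LD (idxSeq (S.host hy 1) (S.refineStep hy) i)).ρq n)) 1) :
    haveI : ∀ m, Finite (LevelData.QuotCarrier (S.QuotRing (i + 1)) (S.refinedRep hy i) m) :=
      fun m => S.finite_refinedQuotCarrier hy i m
    tameSlotOn pins (S.refinedQuotRep hy i) (fun n v => n ∈ levels S.L ∧ v ∈ n) (S.tameHyp_refined hy i) n v
        (ContinuousRep.cohomologyMap (GaloisRep.toLocal v ((S.LD (idxSeq (S.host hy 1) (S.refineStep hy) i)).ρq n))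
          (GaloisRep.toLocal v (S.refinedQuotRep hy i n)) (S.refineFq hy i n).toAddMonoidHom
          continuous_of_discreteTopology (fun _ y => S.refineFq_equivariant hy i n _ y) 1 c) =
      TensorProduct.map (singularQuotientMap ((S.LD (idxSeq (S.host hy 1) (S.refineStep hy) i)).ρq n) (S.refinedQuotRep hy i n) v
          (S.refineFq hy i n).toAddMonoidHom (fun _ y => S.refineFq_equivariant hy i n _ y)).toIntLinearMap
        LinearMap.id ((S.LD (idxSeq (S.host hy 1) (S.refineStep hy) i)).fs n v c) := by
  haveI : ∀ m, Finite (LevelData.QuotCarrier (S.QuotRing (i + 1)) (S.refinedRep hy i) m) :=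
    fun m => S.finite_refinedQuotCarrier hy i m
  have key := tameSlotOn_natural_cohomologyMap pins (S.LD (idxSeq (S.host hy 1) (S.refineStep hy) i)).ρq (S.refinedQuotRep hy i)
    (fun n v => n ∈ levels S.L ∧ v ∈ n) (hPS (idxSeq (S.host hy 1) (S.refineStep hy) i)) (S.tameHyp_refined hy i) n v
    (S.refineFq hy i n).toAddMonoidHom (fun _ y => S.refineFq_equivariant hy i n _ y)
    (singularQuotientMap ((S.LD (idxSeq (S.host hy 1) (S.refineStep hy) i)).ρq n) (S.refinedQuotRep hy i n) v
      (S.refineFq hy i n).toAddMonoidHom (fun _ y => S.refineFq_equivariant hy i n _ y))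
    (fun x => singularQuotientMap_singularMap _ _ v _ _ x) c
  have e1 := DFunLike.congr_fun (congrFun (congrFun (htame (idxSeq (S.host hy 1) (S.refineStep hy) i)) n) v) c
  exact key.trans (congrArg _ e1.symm)

end DVRSetting

end Literature.NumberTheory.GaloisCohomology.Howard2004

end
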